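import Summits.QuantumFields.BalabanUV.Beta.D1BFx.ColumnGaugeCombLetter
import Summits.QuantumFields.BalabanUV.Beta.DshAn1Spread
import Summits.QuantumFields.BalabanUV.Beta.D1BFx.DressedVertexSplit
import Summits.QuantumFields.BalabanUV.Beta.D1BFx.ColumnGaugeGenerator
import Summits.QuantumFields.BalabanUV.Beta.D1BFx.RawStencilSupportRows

/-!
# `BalabanUV.Beta.D1BFx.ColumnGaugeCombPartner` — road «BF-x», binder row D1, PART 24 HEAD (H1) for the COMB LITERAL (chart of record (α′), an2 R-D1-g44-2 ∕
# R-D1-g45-3): **THE COMB LITERAL's FIRST-ORDER SLOT-WARD PARTNER IS THE LEGGED BORDER** — `divV S⁰ u = (n⁴∕2) • conjV (bhK n + Dsh n) (diagK (legInd ρ_c u))`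
# EXACTLY, so F-g23-3's displayed `Dsh`-border word is `[Λ, (n⁴∕2)•(bhK + Dsh − bhKAt ρ_c)]` and, against the road kernel's STRAIGHT partner `bhK`, exactly
# `[Λ, (n⁴∕2)•Dsh n]`; and the bm-DRESSED first-order vertex of the comb literal at the road's kernel is the STRAIGHT one plus ONE commutator with `bhK + Dsh`
# (the (α′) instance's first-order half for the COMB literal — OWNER-MEMO-g23 §3⁗′ «FILE 1-comb», with the `Dsh` word now inside the partner).

WHY.  Gen 23's `ColumnGaugeCombLetter` wrote the comb literal's level-0 letter against the road kernel's ROOTED partner `bhKAt 3 ρ_c n` plus a displayed border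
defect `(−n⁸∕2)•conjV (mfNeg (linSym04At ρ_c n) − mfNeg (linSymAt ρ_c n)) D_u` (F-g23-3; an2 R-D1-g45-3 (1): «built on EXACTLY the `Dsh` of Engine C's STEP 0-B»).
The two border dictionaries of the tree — an2's `WardLocusStencils.bhKAt_eq_ffK_sub_smul_mfNeg_linSymAt` (`bhKAt ρ L = ffK bhKAt − L^{d+1}•mfNeg (linSymAt ρ L)`) and
an1's `DshAn1Spread.bhK_add_Dsh_eq_ffK_sub_smul_mfNeg_linSym04At` (`bhK L + Dsh L = ffK bhK − L^{d+1}•mfNeg (linSym04At ρ_c L)`), with `ffK bhKAt = ffK bhK`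
(`WardLocusStencils.ffK_bhKAt`) — subtract to §1 `bhK L + Dsh L − bhKAt (ctr) L = −L^{d+1}•ΔmfNeg`; at `d + 1 = 4` the defect's scalar `−n⁸∕2 = (n⁴∕2)·(−n⁴)`
turns the displayed word into `(n⁴∕2)•conjV (bhK + Dsh − bhKAt) D_u`, and the two pieces of the comb letter MERGE (§2): the partner is `(n⁴∕2)•(bhK n + Dsh n)` —
the very legged border of which the literal's own resolvent `GcombSh n 0` is the relative inverse (`ChartDefectResolvent.relInv_GcombSh_zero`), answering the OWNER's
Q-g24-1 in the kernel.  §3 composes with leaf-01's `DressedVertexSplit` and `ColumnGaugeGenerator` (as `ColumnGaugeNativeFirstOrder` did for the native spine):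
`vertexOfK G₀^{bm}(ρ_c) n S⁰ μ y = vertexOfK (KInvStep n 0) n S⁰ μ y + [Λc μ y, bhK n + Dsh n]`, `Λc μ y = diagK (z b ↦ (n⁴∕2)·χ_{μ,y} (legSite ρ_c z b))`,
`χ_{μ,y} = bmGaugeAt ρ_c (colH (KInvStep n 0) n μ y) n` — the INPUT shape of `ColumnGaugeTwoPins` §1∕§2 with `M := bhK n`, `D := Dsh n` (up to the scalar `n⁴∕2`
carried by `Λc`).

HONEST DEPENDENCY (cell records, verbatim): «continuum YM on T⁴ ⇐ BetaPertH ∧ nine spine estimates (0/9 proved); BetaPertH ⇐ (D1) ∧ (D4) ∧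
CAP+tail; G-an2-4 gates asym, D1 and NE2/3/4.»  HONEST FRAMING (cell contract, verbatim): «discharging `BetaPertH` makes Bałaban's UV stability
UNCONDITIONAL — a real constructive-QFT result; it is NOT the continuum limit and NOT the Clay problem.»  THIS MODULE DISCHARGES NO binder of row D1 and NO
estimate of Bałaban's: [our object] identities between OUR kernels composed BY NAME (the comb letter `ColumnGaugeCombLetter.divV_S_zero_eq_bhKAt_add_borderDefect`,
the two border dictionaries, `ffK_bhKAt`, leaf-01's `DressedVertexSplit.vertexOfK_coDressKBmAt_eq_sub` + `RawStencilSupportRows.locStencil_JsB12CombSh0_S_zero_of_decays`,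
g53's `PackedColumnEnvelope.abs_colH_KInvStep_zero_le`, `ColumnGaugeGenerator.wsum_divV_eq_conjV_of_letters_smul`).  No definition, no `def … : Prop`, nothing cited,
0 sorry.  The SECOND-order letters of the comb literal (partner of `S₂⁰`'s slots; scalars) are NOT here.  0∕4 row-D1 binders; (K) NOT closed; (J1) ONE OPEN ROW;
NOT D1, NEVER «G-an2-4 closed», NOT `BetaPertH`, NOT continuum, NOT Clay.

ABSOLUTE RULE (cell charter, verbatim): «No internally-minted statement may enter as a cited fact. Every hypothesis is either kernel-proved in this
package or a verbatim quotation of a PUBLISHED theorem with page reference. The manuscript(s) under audit are NOT citable for their own disputed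
steps — they are the thing under adjudication; programme-internal (2001/route/tribunal) claims are never citable.»

Unit `b2b-balaban-beta-d1-p2` (road owner, gen 24), 2026-08-23; no existing file touched.
-/

noncomputable section

namespace Summit.QuantumFields.BalabanUV.Beta.D1BFx.ColumnGaugeCombPartner

open Literature.MathematicalPhysics.QuantumFieldTheory
open Literature.MathematicalPhysics.QuantumFieldTheory.LatticeForm (quo)
open Literature.MathematicalPhysics.QuantumFieldTheory.Balaban1983to89
open Literature.MathematicalPhysics.QuantumFieldTheory.Balaban1983to89.Beta
open B4ContourShift (supNorm)
open ExpKernelCalculus (MKer comp)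
open OneStepResolventKernel (Fib wsum LocStencil)
open OneStepKernelFamily (colH vertexOfK KInvStep)
open KernelWard (divV)
open StepJetData (mfNeg)
open AffineAveraging (Site box toSite)
open AveragingContoursRooted (ctr ctrOff ctrOff_mem_box)
open Summit.QuantumFields.BalabanUV.Beta.TameKernelCalculus (Spr)
open Summit.QuantumFields.BalabanUV.Beta.ChartConjugation (conjV)
open Summit.QuantumFields.BalabanUV.Beta.BorderedHessian (diagK conjV_diagK_apply bhK bhKAt)
open Summit.QuantumFields.BalabanUV.Beta.AxialDressingRooted (coDressKBmAt)
open Summit.QuantumFields.BalabanUV.Beta.AxialProjectorBlockMean (bmGaugeAt)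
open Summit.QuantumFields.BalabanUV.Beta.AveragingWardRootedStencils (legSite legInd linSymAt)
open Summit.QuantumFields.BalabanUV.Beta.WardLocusStencils (ffK ffK_bhKAt bhKAt_eq_ffK_sub_smul_mfNeg_linSymAt)
open Summit.QuantumFields.BalabanUV.Beta.DshAn1 (Dsh linSym04At bhK_add_Dsh_eq_ffK_sub_smul_mfNeg_linSym04At)
open Summit.QuantumFields.BalabanUV.Beta.CombChartStepJets (JsB12CombSh0)
open Summit.QuantumFields.BalabanUV.Beta.SymSecondOrderTablesAn1 (symTablesAn1S2)
open Summit.QuantumFields.BalabanUV.Beta.D1BFx.ColumnGaugeCombLetter (divV_S_zero_eq_bhKAt_add_borderDefect)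
open Summit.QuantumFields.BalabanUV.Beta.D1BFx.PackedColumnEnvelope (abs_colH_KInvStep_zero_le)
open Summit.QuantumFields.BalabanUV.Beta.D1BFx.DressedVertexSplit (vertexOfK_coDressKBmAt_eq_sub)
open Summit.QuantumFields.BalabanUV.Beta.D1BFx.ColumnGaugeGenerator (wsum_divV_eq_conjV_of_letters_smul)
open Summit.QuantumFields.BalabanUV.Beta.D1BFx.RawStencilSupportRows (locStencil_JsB12CombSh0_S_zero_of_decays)
open B5Hk163Strip (kappa163 kappa163_pos)
open B5Hk163Decay (MG163)
open B4TorusKernel (periodConst)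

variable {d : ℕ}

/-! ## §1 The two border dictionaries subtracted: `bhK + Dsh − bhKAt ρ_c = −L^{d+1} • ΔmfNeg` -/

/-- [folklore] **THE LEGGED BORDER MINUS THE ROOTED STRAIGHT BORDER IS an1's SYMMETRISATION DEFECT OF THE BORDER TABLE** (centred root):
`bhK L + Dsh L − bhKAt d (ctr (d+1) L) L = −L^{d+1} • (mfNeg (linSym04At ρ_c L) − mfNeg (linSymAt ρ_c L))` — an1's `bhK_add_Dsh_eq_ffK_sub_smul_mfNeg_linSym04At` minus
an2's `bhKAt_eq_ffK_sub_smul_mfNeg_linSymAt`, the field–field blocks agreeing (`ffK_bhKAt`). -/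
theorem bhK_add_Dsh_sub_bhKAt_ctr (L : ℕ) [NeZero L] :
    bhK L + Dsh (d := d) L - bhKAt d (ctr (d + 1) L) L
      = -(((L : ℝ) ^ (d + 1)) • (mfNeg (linSym04At (ctr (d + 1) L) L) - mfNeg (linSymAt (ctr (d + 1) L) L))) := by
  have h2 := bhKAt_eq_ffK_sub_smul_mfNeg_linSymAt (d := d) (ctr (d + 1) L) L
  rw [ffK_bhKAt] at h2
  rw [bhK_add_Dsh_eq_ffK_sub_smul_mfNeg_linSym04At (d := d) L, h2, smul_sub]
  abel

/-- [folklore] The same at `d + 1 = 4` with the comb literal's scalars: `(−n⁸∕2) • ΔmfNeg = (n⁴∕2) • (bhK n + Dsh n − bhKAt 3 ρ_c n)`. -/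
theorem smul_borderDefect_eq {n : ℕ} [NeZero n] :
    (-((n : ℝ) ^ 8 / 2)) • (mfNeg (linSym04At (ctr 4 n) n) - mfNeg (linSymAt (ctr 4 n) n))
      = ((n : ℝ) ^ 4 / 2) • (bhK n + Dsh (d := 3) n - bhKAt 3 (ctr 4 n) n) := by
  have hn4 : ((n : ℝ) ^ (3 + 1)) ≠ 0 := pow_ne_zero _ (Nat.cast_ne_zero.2 (NeZero.ne n))
  have h := bhK_add_Dsh_sub_bhKAt_ctr (d := 3) n
  -- `Δ = −(n⁴)⁻¹ • (bhK + Dsh − bhKAt)`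
  have hΔ : mfNeg (linSym04At (ctr (3 + 1) n) n) - mfNeg (linSymAt (ctr (3 + 1) n) n)
      = -((((n : ℝ) ^ (3 + 1))⁻¹) • (bhK n + Dsh (d := 3) n - bhKAt 3 (ctr (3 + 1) n) n)) := by
    rw [h, smul_neg, neg_neg, smul_smul, inv_mul_cancel₀ hn4, one_smul]
  show (-((n : ℝ) ^ 8 / 2)) • (mfNeg (linSym04At (ctr (3 + 1) n) n) - mfNeg (linSymAt (ctr (3 + 1) n) n))
      = ((n : ℝ) ^ 4 / 2) • (bhK n + Dsh (d := 3) n - bhKAt 3 (ctr (3 + 1) n) n)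
  rw [hΔ, smul_neg, smul_smul, ← neg_smul]
  congr 1
  have hn4' : ((n : ℝ) ^ 4) ≠ 0 := pow_ne_zero _ (Nat.cast_ne_zero.2 (NeZero.ne n))
  rw [show ((n : ℝ) ^ (3 + 1)) = (n : ℝ) ^ 4 from by norm_num, show ((n : ℝ) ^ 8) = (n : ℝ) ^ 4 * (n : ℝ) ^ 4 from by ring]
  field_simp

/-! ## §2 The comb literal's first-order letter: partner = `(n⁴∕2) • (bhK n + Dsh n)` -/

section Letter

variable {Lc : ℕ} [NeZero Lc]

/-- **THE COMB LITERAL's LEVEL-0 SLOT WARD LETTER HAS THE LEGGED BORDER AS PARTNER** [our object] (Q-g24-1 answered in the kernel): for the literal of record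
`JsB12CombSh0 hLc N (symTablesAn1S2 3 Lc cΛ) cΛ cB`, at level `0`, for every varied site `u`,
`divV S⁰ u = (Lc⁴∕2) • conjV (bhK Lc + Dsh Lc) (diagK (legInd ρ_c u))`, `ρ_c = ctr 4 Lc` — gen 23's `bhKAt`-letter + displayed `Dsh`-border word, MERGED by §1:
the partner is exactly the legged border `bhK + Dsh` of `ChartDefectResolvent.relInv_GcombSh_zero` (scaled by `Lc⁴∕2`). -/
theorem divV_S_zero_eq_smul_conjV_leggedBorder (hLc : Odd Lc) (N : ℕ) (cΛ cB : ℝ) (u : Fin 4 → ℤ) :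
    divV (JsB12CombSh0 hLc N (symTablesAn1S2 3 Lc cΛ) cΛ cB 0).S u
      = ((Lc : ℝ) ^ 4 / 2) • conjV (bhK Lc + Dsh Lc) (diagK (legInd (ctr 4 Lc) u)) := by
  rw [divV_S_zero_eq_bhKAt_add_borderDefect hLc N cΛ cB u]
  have h := smul_borderDefect_eq (n := Lc)
  funext x z a b
  have hx := congrFun (congrFun (congrFun (congrFun h x) z) a) b
  simp only [Pi.add_apply, Pi.sub_apply, Pi.smul_apply, smul_eq_mul, conjV_diagK_apply] at hx ⊢
  -- `hx : (−Lc⁸∕2)·Δ = (Lc⁴∕2)·(bhK + Dsh − bhKAt)` entrywise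
  linear_combination (legInd (ctr 4 Lc) u z b - legInd (ctr 4 Lc) u x a) * hx

/-- [folklore] **… SPLIT AGAINST THE STRAIGHT PARTNER**: `divV S⁰ u = (Lc⁴∕2) • conjV (bhK Lc) D_u + (Lc⁴∕2) • conjV (Dsh Lc) D_u` — against the road kernel's
STRAIGHT `RelInv` partner `bhK` (`ChartDefectResolvent.relInv_G0bm_ctr`) the displayed border word is exactly `(Lc⁴∕2) • conjV (Dsh Lc) D_u` (an2's `G^{Dsh}` per site). -/
theorem divV_S_zero_eq_smul_conjV_bhK_add_Dsh (hLc : Odd Lc) (N : ℕ) (cΛ cB : ℝ) (u : Fin 4 → ℤ) :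
    divV (JsB12CombSh0 hLc N (symTablesAn1S2 3 Lc cΛ) cΛ cB 0).S u
      = ((Lc : ℝ) ^ 4 / 2) • conjV (bhK Lc) (diagK (legInd (ctr 4 Lc) u))
        + ((Lc : ℝ) ^ 4 / 2) • conjV (Dsh Lc) (diagK (legInd (ctr 4 Lc) u)) := by
  rw [divV_S_zero_eq_smul_conjV_leggedBorder hLc N cΛ cB u]
  funext x z a b
  simp only [Pi.add_apply, Pi.smul_apply, smul_eq_mul, conjV_diagK_apply]
  ring

end Letter

/-! ## §3 The bm-dressed first-order vertex of the COMB literal at the road's kernel = the straight one + ONE commutator with the legged border -/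

section Dressed

variable {n : ℕ} [NeZero n]

/-- **THE (α′) FIRST-ORDER INSTANCE FOR THE COMB LITERAL** [our object]: at the road's kernel `G₀^{bm}(ρ_c) = coDressKBmAt (ctr 4 n) n (KInvStep n 0)`
(`ctr 4 n = toSite (ctrOff 4 n)` by `rfl`), for the literal of record's first-order table `S⁰`,
`vertexOfK G₀^{bm} n S⁰ μ y = vertexOfK (KInvStep n 0) n S⁰ μ y + (Λc μ y ∘ (bhK n + Dsh n) − (bhK n + Dsh n) ∘ Λc μ y)`,
`Λc μ y := diagK (z b ↦ (n⁴∕2)·χ_{μ,y} (legSite ρ_c z b))`, `χ_{μ,y} := bmGaugeAt ρ_c (colH (KInvStep n 0) n μ y) n` — leaf-01's dressed vertex split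
(`LocStencil S⁰` from `RawStencilSupportRows`, g53's column envelope) + §2's letter superposed (`ColumnGaugeGenerator.wsum_divV_eq_conjV_of_letters_smul`).
This is the `V + [Λ, M + D]` input of `ColumnGaugeTwoPins` (`M := bhK n`, `D := Dsh n`, scalar in `Λc`). -/
theorem vertexOfK_G0bm_S_zero_eq_add_comm (hodd : Odd n) (N : ℕ) (cΛ cB : ℝ) (μ : Fin 4) (y : Site 4) :
    vertexOfK (coDressKBmAt (ctr 4 n) n (KInvStep (d := 3) n 0)) n (JsB12CombSh0 hodd N (symTablesAn1S2 3 n cΛ) cΛ cB 0).S μ y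
      = vertexOfK (KInvStep (d := 3) n 0) n (JsB12CombSh0 hodd N (symTablesAn1S2 3 n cΛ) cΛ cB 0).S μ y
        + (comp (diagK (fun z b => (n : ℝ) ^ 4 / 2 * bmGaugeAt (ctr 4 n) (colH (KInvStep (d := 3) n 0) n μ y) n (legSite (ctr 4 n) z b)))
              (bhK n + Dsh n)
            - comp (bhK n + Dsh n)
              (diagK (fun z b => (n : ℝ) ^ 4 / 2 * bmGaugeAt (ctr 4 n) (colH (KInvStep (d := 3) n 0) n μ y) n (legSite (ctr 4 n) z b)))) := by
  have hn1 : 1 ≤ n := Nat.one_le_iff_ne_zero.2 (NeZero.ne n)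
  -- the literal's first-order table is a local stencil family
  obtain ⟨δK, CK, hδK, hCK, hKd⟩ := OneStepResolventKernel.decays_KInv (N := n) (d := 3)
  obtain ⟨Cs, -, hS⟩ := locStencil_JsB12CombSh0_S_zero_of_decays hodd N (symTablesAn1S2 3 n cΛ) cΛ cB hKd hCK hδK
  -- g53's block envelope of the straight column
  have hK : ∀ (κ : Fin (3 + 1)) (u : Site (3 + 1)), |colH (KInvStep (d := 3) n 0) n μ y κ u|
      ≤ ((n : ℝ) ^ (3 + 2))⁻¹ * (MG163 (3 + 1) * periodConst (kappa163 (3 + 1)) 3)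
          * Real.exp (-(kappa163 (3 + 1) / ((3 : ℝ) + 1) * supNorm (quo n u - y))) :=
    fun κ u => abs_colH_KInvStep_zero_le (d := 3) (N := n) hn1 μ y κ u
  have hM : 0 ≤ ((n : ℝ) ^ (3 + 2))⁻¹ * (MG163 (3 + 1) * periodConst (kappa163 (3 + 1)) 3) :=
    (mul_nonneg_iff_of_pos_right (Real.exp_pos _)).1 ((abs_nonneg _).trans (hK 0 0))
  have hc : 0 < kappa163 (3 + 1) / ((3 : ℝ) + 1) := div_pos (kappa163_pos (3 + 1)) (by positivity)
  have hsplit := vertexOfK_coDressKBmAt_eq_sub hn1 (ctrOff_mem_box hn1) (KInvStep (d := 3) n 0) hS (half_pos hδK) μ y hM hc hK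
  rw [show toSite (ctrOff (3 + 1) n) = ctr 4 n from rfl] at hsplit
  rw [hsplit,
    show wsum (bmGaugeAt (ctr 4 n) (colH (KInvStep (d := 3) n 0) n μ y) n) (divV (JsB12CombSh0 hodd N (symTablesAn1S2 3 n cΛ) cΛ cB 0).S)
      = wsum (bmGaugeAt (ctr 4 n) (colH (KInvStep (d := 3) n 0) n μ y) n) (fun u => divV (JsB12CombSh0 hodd N (symTablesAn1S2 3 n cΛ) cΛ cB 0).S u) from rfl,
    wsum_divV_eq_conjV_of_letters_smul (fun u => divV_S_zero_eq_smul_conjV_leggedBorder hodd N cΛ cB u)]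
  abel

/-- [folklore] **… WITH THE `Dsh` WORD DISPLAYED**: the same, the commutator split into the STRAIGHT-partner part `[Λc, bhK n]` (cancelled at the road's pin by
`hessKer_columnGauge_of_relInv` at `(G₀^{bm}, bhK, axEc)`) and the border word `G^{Dsh} μ y := [Λc μ y, Dsh n]` (priced, R-D1-g45-3 (2)). -/
theorem vertexOfK_G0bm_S_zero_eq_add_comm_add_Dsh (hodd : Odd n) (N : ℕ) (cΛ cB : ℝ) (μ : Fin 4) (y : Site 4) :
    vertexOfK (coDressKBmAt (ctr 4 n) n (KInvStep (d := 3) n 0)) n (JsB12CombSh0 hodd N (symTablesAn1S2 3 n cΛ) cΛ cB 0).S μ y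
      = vertexOfK (KInvStep (d := 3) n 0) n (JsB12CombSh0 hodd N (symTablesAn1S2 3 n cΛ) cΛ cB 0).S μ y
        + (comp (diagK (fun z b => (n : ℝ) ^ 4 / 2 * bmGaugeAt (ctr 4 n) (colH (KInvStep (d := 3) n 0) n μ y) n (legSite (ctr 4 n) z b))) (bhK n)
            - comp (bhK n) (diagK (fun z b => (n : ℝ) ^ 4 / 2 * bmGaugeAt (ctr 4 n) (colH (KInvStep (d := 3) n 0) n μ y) n (legSite (ctr 4 n) z b))))
        + (comp (diagK (fun z b => (n : ℝ) ^ 4 / 2 * bmGaugeAt (ctr 4 n) (colH (KInvStep (d := 3) n 0) n μ y) n (legSite (ctr 4 n) z b))) (Dsh n)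
            - comp (Dsh n) (diagK (fun z b => (n : ℝ) ^ 4 / 2 * bmGaugeAt (ctr 4 n) (colH (KInvStep (d := 3) n 0) n μ y) n (legSite (ctr 4 n) z b)))) := by
  rw [vertexOfK_G0bm_S_zero_eq_add_comm hodd N cΛ cB μ y]
  funext x z a b
  simp only [Pi.add_apply, Pi.sub_apply, Summit.QuantumFields.BalabanUV.Beta.BorderedHessian.comp_diagK_left,
    Summit.QuantumFields.BalabanUV.Beta.BorderedHessian.comp_diagK_right]
  ring

end Dressed

end Summit.QuantumFields.BalabanUV.Beta.D1BFx.ColumnGaugeCombPartner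

end
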